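import Summits.AtomisticToContinuum.BoseEinsteinCondensation.Theorems.BECCutLineWeakDisorderLateCoreSplitLateWitnessTransfer
import Summits.AtomisticToContinuum.BoseEinsteinCondensation.Theorems.BECCutLineWeakDisorderLateCoreSplitOfCrux
import Summits.AtomisticToContinuum.BoseEinsteinCondensation.Theorems.BECCutLineWeakDisorderAssembly
import Summits.AtomisticToContinuum.BoseEinsteinCondensation.Theorems.BECCutLineWeakDisorderFlatModeFromLandscape
import Summits.AtomisticToContinuum.BoseEinsteinCondensation.Theorems.BECCutLineWeakDisorderOccupationStability
import Summits.AtomisticToContinuum.BoseEinsteinCondensation.Theorems.BECCutLineWeakDisorderZeroModeOfLandscape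
import HarnessLib

/-!
# Route `BECCutLineWeakDisorder`, crux `TwoReplicaTransienceBound` (stmt-AtomisticToContinuum-9687), line
# `late-core-split`: the deciding-theorem candidate after the split — `Z → A → GroundStateRigidity → BEC`

Support file (`--supports stmt-AtomisticToContinuum-9687`, registered toolbox stub `stub_becOfLateCore`;
lead c7). The route's deciding theorem `closes : TwoReplicaTransienceBound → WitnessTransfer →
GroundStateRigidity → BoseEinsteinCondensation` consumes the crux only through the hinge
`LandscapeBound := WitnessTransfer crux`. With the LANDED `stub_lateWitnessTransfer` the hinge follows
from the two late-time statements `WitnessZeroMode` (Z) and `OverlapNoIntermittency` (A) alone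
(`landscapeBound_of_zeroMode_noIntermittency`, `…LateCoreSplitLateWitnessTransfer.lean`), and the rest of
the route is closed (`Assembly` stmt-9090, `FlatModeFromLandscape` stmt-9088, `OccupationStability`
stmt-9074, `ZeroModeOfLandscape` stmt-9089 — all proved). Composing:

  `stub_becOfLateCore : WitnessZeroMode → OverlapNoIntermittency → GroundStateRigidity → BoseEinsteinCondensation`,

sorry-free — the theorem a tenure planner can install as the route's deciding theorem once Z and A are
filed as items (the `∀ T ≥ 1` parent crux and `NoTransientOvershoot` then leave the critical path;
`stub_splitOfCrux` certifies that nothing is lost). Z is the summit-strength core (late-time flat-mode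
ODLRO of the heat-flow witness, uniformly in the particle number); this file makes that reading literal:
modulo the difficulty-M rigidity crux and the side condition A, Z IS Bose–Einstein condensation for this
route.
-/

noncomputable section

namespace Summit.AtomisticToContinuum.BoseEinsteinCondensation.Cruxes.TwoReplicaTransienceBound.LateCoreSplit

open Summit.AtomisticToContinuum.BoseEinsteinCondensation.Theses.BECCutLineWeakDisorder

/-- **Registered toolbox stub `stub_becOfLateCore`** — the route BECCutLineWeakDisorder closes from
`WitnessZeroMode`, `OverlapNoIntermittency` and `GroundStateRigidity`: hinge by
`landscapeBound_of_zeroMode_noIntermittency`, then the proved items `Assembly` (stmt-9090) fed with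
`FlatModeFromLandscape` (stmt-9088), `OccupationStability` (stmt-9074), `ZeroModeOfLandscape` (stmt-9089). -/
theorem stub_becOfLateCore : WitnessZeroMode → OverlapNoIntermittency → GroundStateRigidity → _root_.BoseEinsteinCondensation :=
  fun hZ hA hR =>
    Summit.AtomisticToContinuum.BoseEinsteinCondensation.Theorems.becCutLineWeakDisorder_assembly_proof
      (landscapeBound_of_zeroMode_noIntermittency hZ hA) hR
      Summit.AtomisticToContinuum.BoseEinsteinCondensation.Theorems.flatModeFromLandscape_proof
      Summit.AtomisticToContinuum.BoseEinsteinCondensation.Theorems.occupationStability_proof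
      Summit.AtomisticToContinuum.BoseEinsteinCondensation.Theorems.zeroModeOfLandscape_proof

/-- The route's present deciding theorem FACTORS through the late core: the crux gives `Z ∧ A`
(`witnessZeroMode_of_crux`, `overlapNoIntermittency_of_crux`), and `Z`, `A`, rigidity give BEC. -/
theorem bec_of_crux_of_rigidity (hT : TwoReplicaTransienceBound) (hR : GroundStateRigidity) :
    _root_.BoseEinsteinCondensation :=
  stub_becOfLateCore (witnessZeroMode_of_crux hT) (overlapNoIntermittency_of_crux hT) hR

end Summit.AtomisticToContinuum.BoseEinsteinCondensation.Cruxes.TwoReplicaTransienceBound.LateCoreSplit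

end
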